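import Mathlib.Data.ZMod.Basic
import Mathlib.Algebra.BigOperators.Pi
import Mathlib.Algebra.Module.BigOperators
import Mathlib.Algebra.Module.Pi
import Literature.Computability.Complexity.CodeFPListKit
import Literature.Computability.Complexity.CodeFPLists
import Literature.Computability.Complexity.HadamardPCP
import HarnessLib

/-!
# Row reduction over `𝔽₂` on bit lists: reduced echelon form, kernel basis, and its `CodeFP`

Topic `Literature/Computability/Complexity` (toolkit; companion of `GaussRankList.lean` /
`GaussRankFP.lean`, which compute the RANK of a list of rows over a field). This file treats the
field `𝔽₂` with rows given as BIT LISTS (entry `c` of a row `r` is `r.getD c false`, so rows may be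
ragged) and computes, by the schoolbook column sweep (von zur Gathen–Gerhard, *Modern Computer
Algebra*, §12.1; Knuth TAOCP Vol. 2, §4.6.2, Algorithm N for the null space), a **reduced echelon
form with pivot labels** from which a **basis of the kernel** `{d | M d = 0}` is read off:

* `F2Elim.rstep S j` — one column: the first unlabelled row with a `1` in column `j` becomes the
  pivot row labelled `j` (moved to the front) and is added to every other row with a `1` in column
  `j`; `F2Elim.rrun t M` — the sweep over the columns `0, …, t-1`;
* `F2Elim.pivRow S c` (the row labelled `c`, if any), `F2Elim.isPiv`, `F2Elim.kvec n S f` — the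
  kernel vector attached to a free column `f` (`1` at `f`, the entry `(pivRow c)_f` at each pivot
  column `c`, `0` elsewhere);
* the readings in `𝔽₂ = ZMod 2` (through the tree's `BLR.toZ : Bool → ZMod 2`): `vecZ n r : Fin n → ZMod 2`, `dotZ`, the kernel
  `kerSet n M = {d | ∀ r ∈ M, r · d = 0}`;
* **invariant and correctness** (all proved): `Inv` (labels `< t` sit on a `1`, a `1` in a pivot
  column identifies the pivot row, unlabelled rows vanish on the swept columns, and the row spans of
  `M` and of the state coincide), `inv_rrun`; whence for `S = rrun n M`:
  `kerSet_eq_kerSet_rows` (same kernel), `vecZ_kvec_mem_kerSet` (**K1**: the `kvec f` lie in the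
  kernel), `eq_sum_kvec_of_mem_kerSet` (**K2**: a kernel vector is the sum of the `kvec f` over its
  free coordinates `f` with `d_f = 1`), `exists_combination_of_orth_kerSet` (**K3**: a vector
  orthogonal to the kernel is a sum of rows of `M`);
* `CodeFP` facts: `rstep_codeFP`, `rrun_codeFP`, `pivRow_codeFP`, `kvec_codeFP` (polynomial time on
  the codes `rawE bitE` of rows, through the combinators of `CodeFP.lean`).

## References

* J. von zur Gathen, J. Gerhard, *Modern Computer Algebra*, 3rd ed., CUP 2013, §12.1 (Gaussian
  elimination, reduced row echelon form). [VonzurgathenGerhard2013]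
* D. E. Knuth, *The Art of Computer Programming*, Vol. 2, 3rd ed., §4.6.2, Algorithm N (null space
  by column reduction). [KnuthTAOCP2]
* S. Arora, B. Barak, *Computational Complexity: A Modern Approach*, CUP 2009, §1.3 (polynomial
  time). [AroraBarak2009]
-/

namespace Literature.Computability.Complexity

namespace F2Elim

open CodeFP Finset
open BLR (toZ toZ_xor toZ_and toZ_injective)

/-! ### Rows as bit lists; the column sweep -/

/-- Entrywise xor of two bit lists, padded (entry `c` of the result is the xor of the entries).
[folklore] -/
def bxorL (u v : List Bool) : List Bool := zipWithPad (fun a b => (a ^^ b)) false false u v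

/-- A row of the sweep state: its pivot label (the column it is the pivot of, if any) and its
entries. [folklore] -/
abbrev Row : Type := Option ℕ × List Bool

/-- Pivot candidates for column `j`: unlabelled rows with a `1` in column `j`. [folklore] -/
def cand (j : ℕ) (x : Row) : Bool := x.1.isNone && x.2.getD j false

/-- Clearing column `j` of a row with the pivot row `p` (`p_j = 1`): add `p` iff the row has a `1`
in column `j`; labels are kept. [cite: VonzurgathenGerhard2013, §12.1] -/
def elimRow (j : ℕ) (p : List Bool) (x : Row) : Row := if x.2.getD j false then (x.1, bxorL x.2 p) else x

/-- The pivot row chosen for column `j` (junk `[]` if there is no candidate). [folklore] -/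
def pivOf (S : List Row) (j : ℕ) : List Bool := (S.getD (S.findIdx (cand j)) (none, [])).2

/-- **One column of the sweep.** If some unlabelled row has a `1` in column `j`, the first such row
becomes the pivot row labelled `j`, is moved to the front, and column `j` is cleared from all other
rows; otherwise nothing happens (`j` is a free column). [cite: VonzurgathenGerhard2013, §12.1] -/
def rstep (S : List Row) (j : ℕ) : List Row :=
  if S.findIdx (cand j) < S.length then
    (some j, pivOf S j) :: ((S.eraseIdx (S.findIdx (cand j))).map (elimRow j (pivOf S j)))
  else S

/-- The initial state: all rows unlabelled. [folklore] -/
def initS (M : List (List Bool)) : List Row := M.map fun r => (none, r)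

/-- **The sweep over the columns `0, …, t-1`.** [cite: VonzurgathenGerhard2013, §12.1] -/
def rrun (t : ℕ) (M : List (List Bool)) : List Row := (List.range t).foldl rstep (initS M)

/-- The row labelled `c` in a state, if any (the first one; all rows labelled `c` coincide, see
`Inv`). [folklore] -/
def pivRow (S : List Row) (c : ℕ) : Option (List Bool) := (S.find? fun x => x.1 == some c).map Prod.snd

/-- `c` is a pivot column of the state. [folklore] -/
def isPiv (S : List Row) (c : ℕ) : Bool := (pivRow S c).isSome

/-- Entry `c` of the kernel vector attached to the column `f`: `1` at `c = f`, the entry `f` of the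
pivot row of `c` at a pivot column `c`, `0` elsewhere. [cite: KnuthTAOCP2, §4.6.2 Algorithm N] -/
def kEntry (S : List Row) (f c : ℕ) : Bool := decide (c = f) || ((pivRow S c).elim false fun r => r.getD f false)

/-- **The kernel vector attached to the (free) column `f`**, as a bit list of length `n`.
[cite: KnuthTAOCP2, §4.6.2 Algorithm N] -/
def kvec (n : ℕ) (S : List Row) (f : ℕ) : List Bool := (List.range n).map (kEntry S f)

/-! ### Readings in `𝔽₂` -/

/-- `toZ b = 0 ↔ b = false` (for the tree's `BLR.toZ : Bool → ZMod 2`, `HadamardPCP.lean`).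
[folklore] -/
theorem toZ_eq_zero_iff (b : Bool) : toZ b = 0 ↔ b = false := by cases b <;> decide

/-- `toZ b = 1 ↔ b = true`. [folklore] -/
theorem toZ_eq_one_iff (b : Bool) : toZ b = 1 ↔ b = true := by cases b <;> decide

/-- Every element of `𝔽₂` is a bit. [folklore] -/
theorem toZ_surjective (z : ZMod 2) : ∃ b, toZ b = z := by
  fin_cases z
  · exact ⟨false, rfl⟩
  · exact ⟨true, rfl⟩

/-- The vector in `𝔽₂ⁿ` read off a bit list (entries beyond the end are `0`). [folklore] -/
def vecZ (n : ℕ) (r : List Bool) : Fin n → ZMod 2 := fun i => toZ (r.getD i false)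

/-- The dot product on `𝔽₂ⁿ`. [folklore] -/
def dotZ {n : ℕ} (v w : Fin n → ZMod 2) : ZMod 2 := ∑ i, v i * w i

/-- **The kernel** of a list of rows: the vectors orthogonal to every row. [folklore] -/
def kerSet (n : ℕ) (M : List (List Bool)) : Set (Fin n → ZMod 2) := {d | ∀ r ∈ M, dotZ (vecZ n r) d = 0}

/-- The dot product is additive on the left. [folklore] -/
theorem dotZ_add_left {n : ℕ} (u v w : Fin n → ZMod 2) : dotZ (u + v) w = dotZ u w + dotZ v w := by
  simp [dotZ, add_mul, sum_add_distrib]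

/-- The dot product is additive on the right. [folklore] -/
theorem dotZ_add_right {n : ℕ} (u v w : Fin n → ZMod 2) : dotZ u (v + w) = dotZ u v + dotZ u w := by
  simp [dotZ, mul_add, sum_add_distrib]

/-- The dot product with `0`. [folklore] -/
theorem dotZ_zero_left {n : ℕ} (w : Fin n → ZMod 2) : dotZ 0 w = 0 := by simp [dotZ]

/-- The dot product is homogeneous on the left. [folklore] -/
theorem dotZ_smul_left {n : ℕ} (a : ZMod 2) (v w : Fin n → ZMod 2) : dotZ (a • v) w = a * dotZ v w := by
  simp [dotZ, mul_sum, mul_assoc]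

/-- The dot product is symmetric. [folklore] -/
theorem dotZ_comm {n : ℕ} (v w : Fin n → ZMod 2) : dotZ v w = dotZ w v := by
  simp [dotZ, mul_comm]

/-- The dot product of a sum. [folklore] -/
theorem dotZ_sum_left {n : ℕ} {ι : Type*} (s : Finset ι) (v : ι → Fin n → ZMod 2) (w : Fin n → ZMod 2) :
    dotZ (∑ k ∈ s, v k) w = ∑ k ∈ s, dotZ (v k) w := by
  classical
  induction s using Finset.induction_on with
  | empty => simp [dotZ_zero_left]
  | insert a s ha ih => rw [sum_insert ha, sum_insert ha, dotZ_add_left, ih]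

/-- The dot product with a basis vector reads a coordinate. [folklore] -/
theorem dotZ_single_left {n : ℕ} (i : Fin n) (w : Fin n → ZMod 2) : dotZ (Pi.single i 1) w = w i := by
  simp [dotZ, Pi.single_apply]

/-- Entries of `bxorL`. [folklore] -/
theorem getD_bxorL (u v : List Bool) (c : ℕ) : (bxorL u v).getD c false = (u.getD c false ^^ v.getD c false) := by
  unfold bxorL
  by_cases hc : c < max u.length v.length
  · exact getD_zipWithPad _ _ _ _ _ c false hc
  · push Not at hc
    rw [List.getD_eq_default _ _ (by rw [length_zipWithPad]; exact hc),
      List.getD_eq_default _ _ (le_of_max_le_left hc), List.getD_eq_default _ _ (le_of_max_le_right hc)]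
    rfl

/-- `bxorL` reads as addition in `𝔽₂ⁿ`. [folklore] -/
theorem vecZ_bxorL (n : ℕ) (u v : List Bool) : vecZ n (bxorL u v) = vecZ n u + vecZ n v := by
  funext i; simp only [vecZ, Pi.add_apply, getD_bxorL, toZ_xor]

/-- The length of `bxorL`. [folklore] -/
theorem length_bxorL (u v : List Bool) : (bxorL u v).length = max u.length v.length := length_zipWithPad _ _ _ _ _


/-! ### Row spans -/

/-- The set of row vectors of a list of bit rows. [folklore] -/
def rowSet (n : ℕ) (M : List (List Bool)) : Set (Fin n → ZMod 2) := {v | ∃ r ∈ M, vecZ n r = v}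

/-- The row span over `𝔽₂`. [folklore] -/
def rowSpan (n : ℕ) (M : List (List Bool)) : Submodule (ZMod 2) (Fin n → ZMod 2) :=
  Submodule.span (ZMod 2) (rowSet n M)

/-- Rows lie in the row span. [folklore] -/
theorem vecZ_mem_rowSpan {n : ℕ} {M : List (List Bool)} {r : List Bool} (h : r ∈ M) : vecZ n r ∈ rowSpan n M :=
  Submodule.subset_span ⟨r, h, rfl⟩

/-- The rows (second components) of a state. [folklore] -/
def rowsOf (S : List Row) : List (List Bool) := S.map Prod.snd

/-- The row of a member of the state is a row of the state. [folklore] -/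
theorem mem_rowsOf {S : List Row} {x : Row} (h : x ∈ S) : x.2 ∈ rowsOf S := List.mem_map.2 ⟨x, h, rfl⟩

/-- Membership in `rowsOf`. [folklore] -/
theorem mem_rowsOf_iff {S : List Row} {r : List Bool} : r ∈ rowsOf S ↔ ∃ x ∈ S, x.2 = r := List.mem_map

/-- The rows of the initial state are the input rows. [folklore] -/
@[simp] theorem rowsOf_initS (M : List (List Bool)) : rowsOf (initS M) = M := by
  simp [rowsOf, initS, List.map_map, Function.comp_def]

/-! ### The pivot of a column -/

/-- When column `j` has a candidate, the chosen pivot is an unlabelled row of the state with a `1`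
in column `j`, sitting at the index `findIdx`. [folklore] -/
theorem pivot_spec {S : List Row} {j : ℕ} (h : S.findIdx (cand j) < S.length) :
    (S[S.findIdx (cand j)]).1 = none ∧ (S[S.findIdx (cand j)]).2.getD j false = true ∧
      pivOf S j = (S[S.findIdx (cand j)]).2 := by
  have hc : cand j S[S.findIdx (cand j)] = true := List.findIdx_getElem (w := h)
  simp only [cand, Bool.and_eq_true, Option.isNone_iff_eq_none] at hc
  refine ⟨hc.1, hc.2, ?_⟩
  rw [pivOf, List.getD_eq_getElem _ _ h]

/-- Membership in the new state after a pivot step. [folklore] -/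
theorem mem_rstep_iff {S : List Row} {j : ℕ} (h : S.findIdx (cand j) < S.length) (y : Row) :
    y ∈ rstep S j ↔ y = (some j, pivOf S j) ∨ ∃ x ∈ S.eraseIdx (S.findIdx (cand j)), y = elimRow j (pivOf S j) x := by
  rw [rstep, if_pos h, List.mem_cons, List.mem_map]
  constructor
  · rintro (rfl | ⟨x, hx, rfl⟩)
    · exact Or.inl rfl
    · exact Or.inr ⟨x, hx, rfl⟩
  · rintro (rfl | ⟨x, hx, rfl⟩)
    · exact Or.inl rfl
    · exact Or.inr ⟨x, hx, rfl⟩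

/-- A free column leaves the state unchanged. [folklore] -/
theorem rstep_of_not {S : List Row} {j : ℕ} (h : ¬ S.findIdx (cand j) < S.length) : rstep S j = S := by
  rw [rstep, if_neg h]

/-- Every row of the old state is the pivot or survives in `eraseIdx`. [folklore] -/
theorem mem_split {S : List Row} {j : ℕ} (h : S.findIdx (cand j) < S.length) {x : Row} (hx : x ∈ S) :
    x = S[S.findIdx (cand j)] ∨ x ∈ S.eraseIdx (S.findIdx (cand j)) := by
  obtain ⟨k, hk, rfl⟩ := List.mem_iff_getElem.1 hx
  by_cases hki : k = S.findIdx (cand j)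
  · left; simp [hki]
  · right; exact List.mem_eraseIdx_iff_getElem.2 ⟨k, hk, hki, rfl⟩

/-- Entries of an eliminated row. [folklore] -/
theorem getD_elimRow (j : ℕ) (p : List Bool) (x : Row) (c : ℕ) :
    (elimRow j p x).2.getD c false = (x.2.getD c false ^^ (x.2.getD j false && p.getD c false)) := by
  unfold elimRow
  cases hx : x.2.getD j false
  · simp
  · rw [if_pos rfl, Bool.true_and]
    exact getD_bxorL _ _ _

/-- Elimination keeps labels. [folklore] -/
@[simp] theorem elimRow_fst (j : ℕ) (p : List Bool) (x : Row) : (elimRow j p x).1 = x.1 := by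
  unfold elimRow; split_ifs <;> rfl

/-- The reading of an eliminated row. [folklore] -/
theorem vecZ_elimRow (n j : ℕ) (p : List Bool) (x : Row) :
    vecZ n (elimRow j p x).2 = vecZ n x.2 + toZ (x.2.getD j false) • vecZ n p := by
  unfold elimRow
  cases hx : x.2.getD j false
  · simp [BLR.toZ]
  · simp [vecZ_bxorL, BLR.toZ]

/-! ### The invariant of the sweep -/

/-- **The invariant after sweeping the columns `< t`.** (1) a label `c` is `< t` and sits on a `1`;
(2) a `1` in a pivot column identifies the pivot row (so pivot rows labelled alike coincide, and a
pivot row vanishes at the other pivot columns); (3) unlabelled rows vanish on all swept columns;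
(4)/(5) the row span of the state is the row span of `M`. [cite: VonzurgathenGerhard2013, §12.1] -/
structure Inv (n t : ℕ) (M : List (List Bool)) (S : List Row) : Prop where
  label : ∀ x ∈ S, ∀ c, x.1 = some c → c < t ∧ x.2.getD c false = true
  excl : ∀ x ∈ S, ∀ y ∈ S, ∀ c, y.1 = some c → x.2.getD c false = true → x = y
  unlab : ∀ x ∈ S, x.1 = none → ∀ c, c < t → x.2.getD c false = false
  span₁ : ∀ x ∈ S, vecZ n x.2 ∈ rowSpan n M
  span₂ : ∀ r ∈ M, vecZ n r ∈ rowSpan n (rowsOf S)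

/-- The invariant holds initially. [folklore] -/
theorem inv_initS (n : ℕ) (M : List (List Bool)) : Inv n 0 M (initS M) := by
  refine ⟨?_, ?_, ?_, ?_, ?_⟩
  · intro x hx c hc
    obtain ⟨r, -, rfl⟩ := List.mem_map.1 hx
    exact absurd hc (by simp)
  · intro x hx y hy c hc
    obtain ⟨r, -, rfl⟩ := List.mem_map.1 hy
    exact absurd hc (by simp)
  · intro x _ _ c hc
    exact absurd hc (Nat.not_lt_zero c)
  · intro x hx
    obtain ⟨r, hr, rfl⟩ := List.mem_map.1 hx
    exact vecZ_mem_rowSpan hr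
  · intro r hr
    rw [rowsOf_initS]
    exact vecZ_mem_rowSpan hr

/-- **One column preserves the invariant.** [cite: VonzurgathenGerhard2013, §12.1] -/
theorem inv_rstep {n t : ℕ} {M : List (List Bool)} {S : List Row} (hS : Inv n t M S) :
    Inv n (t + 1) M (rstep S t) := by
  by_cases h : S.findIdx (cand t) < S.length
  swap
  · -- no candidate: `t` is a free column
    rw [rstep_of_not h]
    have hfree : ∀ x ∈ S, cand t x = false := List.findIdx_eq_length.1
      (le_antisymm List.findIdx_le_length (Nat.not_lt.1 h))
    refine ⟨fun x hx c hc => ⟨(hS.label x hx c hc).1.trans (Nat.lt_succ_self t), (hS.label x hx c hc).2⟩,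
      hS.excl, ?_, hS.span₁, hS.span₂⟩
    intro x hx hnone c hc
    rcases Nat.lt_succ_iff_lt_or_eq.1 hc with hc | rfl
    · exact hS.unlab x hx hnone c hc
    · have := hfree x hx
      simp only [cand, hnone, Option.isNone_none, Bool.true_and] at this
      exact this
  -- a pivot is found; abbreviate the pivot index and row
  obtain ⟨hpnone, hpj, hpiv⟩ := pivot_spec h
  generalize hi : S.findIdx (cand t) = i at *
  generalize hp : pivOf S t = p at *
  have hrs : rstep S t = (some t, p) :: ((S.eraseIdx i).map (elimRow t p)) := by
    rw [rstep, hi, if_pos h, hp]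
  have hmem : ∀ y, y ∈ rstep S t ↔ y = (some t, p) ∨ ∃ x ∈ S.eraseIdx i, y = elimRow t p x := by
    intro y
    rw [hrs, List.mem_cons, List.mem_map]
    constructor
    · rintro (rfl | ⟨x, hx, rfl⟩)
      · exact Or.inl rfl
      · exact Or.inr ⟨x, hx, rfl⟩
    · rintro (rfl | ⟨x, hx, rfl⟩)
      · exact Or.inl rfl
      · exact Or.inr ⟨x, hx, rfl⟩
  have hsplit : ∀ x ∈ S, x = S[i] ∨ x ∈ S.eraseIdx i := by
    intro x hx
    obtain ⟨k, hk, rfl⟩ := List.mem_iff_getElem.1 hx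
    by_cases hki : k = i
    · left; simp [hki]
    · right; exact List.mem_eraseIdx_iff_getElem.2 ⟨k, hk, hki, rfl⟩
  have hpS : S[i] ∈ S := List.getElem_mem h
  -- the pivot row vanishes on the swept columns
  have hp0 : ∀ c, c < t → p.getD c false = false := fun c hc => by
    rw [hpiv]; exact hS.unlab _ hpS hpnone c hc
  have hpt : p.getD t false = true := by rw [hpiv]; exact hpj
  have hE : ∀ x ∈ S.eraseIdx i, x ∈ S := fun x hx => List.mem_of_mem_eraseIdx hx
  -- entry `t` is cleared in every eliminated row
  have hclear : ∀ x : Row, (elimRow t p x).2.getD t false = false := by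
    intro x
    rw [getD_elimRow, hpt, Bool.and_true, Bool.xor_self]
  -- entries at swept pivot columns are unchanged by elimination
  have hkeep : ∀ x : Row, ∀ c, c < t → (elimRow t p x).2.getD c false = x.2.getD c false := by
    intro x c hc
    rw [getD_elimRow, hp0 c hc, Bool.and_false, Bool.xor_false]
  refine ⟨?_, ?_, ?_, ?_, ?_⟩
  · -- labels
    intro y hy c hc
    rcases (hmem y).1 hy with rfl | ⟨x, hx, rfl⟩
    · simp only [Option.some.injEq] at hc
      subst hc
      exact ⟨Nat.lt_succ_self _, hpt⟩
    · rw [elimRow_fst] at hc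
      obtain ⟨hct, hxc⟩ := hS.label x (hE x hx) c hc
      exact ⟨hct.trans (Nat.lt_succ_self t), by rw [hkeep x c hct]; exact hxc⟩
  · -- exclusivity
    intro y hy y' hy' c hc hyc
    rcases (hmem y').1 hy' with rfl | ⟨x', hx', rfl⟩
    · -- `y'` is the new pivot, `c = t`
      simp only [Option.some.injEq] at hc
      subst hc
      rcases (hmem y).1 hy with rfl | ⟨x, hx, rfl⟩
      · rfl
      · exact absurd hyc (by rw [hclear x]; exact Bool.false_ne_true)
    · -- `y'` is an old pivot row labelled `c < t`
      rw [elimRow_fst] at hc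
      have hct : c < t := (hS.label x' (hE x' hx') c hc).1
      rcases (hmem y).1 hy with rfl | ⟨x, hx, rfl⟩
      · exact absurd hyc (by simp only; rw [hp0 c hct]; exact Bool.false_ne_true)
      · rw [hkeep x c hct] at hyc
        rw [hS.excl x (hE x hx) x' (hE x' hx') c hc hyc]
  · -- unlabelled rows vanish on the columns `< t + 1`
    intro y hy hnone c hc
    rcases (hmem y).1 hy with rfl | ⟨x, hx, rfl⟩
    · exact absurd hnone (by simp)
    · rw [elimRow_fst] at hnone
      rcases Nat.lt_succ_iff_lt_or_eq.1 hc with hc | rfl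
      · rw [hkeep x c hc]; exact hS.unlab x (hE x hx) hnone c hc
      · exact hclear x
  · -- new rows lie in the row span of `M`
    intro y hy
    rcases (hmem y).1 hy with rfl | ⟨x, hx, rfl⟩
    · simp only; rw [hpiv]; exact hS.span₁ _ hpS
    · rw [vecZ_elimRow]
      exact Submodule.add_mem _ (hS.span₁ x (hE x hx)) (Submodule.smul_mem _ _ (by rw [hpiv]; exact hS.span₁ _ hpS))
  · -- the rows of `M` lie in the row span of the new state
    have hsub : rowSpan n (rowsOf S) ≤ rowSpan n (rowsOf (rstep S t)) := by
      apply Submodule.span_le.2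
      rintro v ⟨r, hr, rfl⟩
      obtain ⟨x, hx, rfl⟩ := mem_rowsOf_iff.1 hr
      have hpmem : vecZ n p ∈ rowSpan n (rowsOf (rstep S t)) :=
        vecZ_mem_rowSpan (mem_rowsOf ((hmem _).2 (Or.inl rfl)))
      rcases hsplit x hx with rfl | hx'
      · rw [← hpiv]; exact hpmem
      · have hxmem : vecZ n (elimRow t p x).2 ∈ rowSpan n (rowsOf (rstep S t)) :=
          vecZ_mem_rowSpan (mem_rowsOf ((hmem _).2 (Or.inr ⟨x, hx', rfl⟩)))
        have e : vecZ n x.2 = vecZ n (elimRow t p x).2 + toZ (x.2.getD t false) • vecZ n p := by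
          rw [vecZ_elimRow, add_assoc, ← add_smul, CharTwo.add_self_eq_zero, zero_smul, add_zero]
        rw [e]
        exact Submodule.add_mem _ hxmem (Submodule.smul_mem _ _ hpmem)
    exact fun r hr => hsub (hS.span₂ r hr)

/-- **The invariant after the sweep.** [cite: VonzurgathenGerhard2013, §12.1] -/
theorem inv_rrun (n t : ℕ) (M : List (List Bool)) : Inv n t M (rrun t M) := by
  induction t with
  | zero => exact inv_initS n M
  | succ t ih =>
    rw [rrun, List.range_succ, List.foldl_append, List.foldl_cons, List.foldl_nil]
    exact inv_rstep ih


/-! ### Reading the final state: pivots, pivot rows, the kernel equations -/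

section Final

variable {n t : ℕ} {M : List (List Bool)} {S : List Row}

/-- `isPiv` detects the labels present in the state. [folklore] -/
theorem isPiv_iff {S : List Row} {c : ℕ} : isPiv S c = true ↔ ∃ x ∈ S, x.1 = some c := by
  rw [isPiv, pivRow, Option.isSome_map, List.find?_isSome]
  simp only [beq_iff_eq]

/-- The pivot row of `c` is a row of the state labelled `c`. [folklore] -/
theorem mem_of_pivRow {S : List Row} {c : ℕ} {r : List Bool} (h : pivRow S c = some r) : (some c, r) ∈ S := by
  rw [pivRow] at h
  obtain ⟨x, hx, rfl⟩ := Option.map_eq_some_iff.1 h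
  have h1 : x.1 = some c := by simpa using List.find?_some hx
  have hm : x ∈ S := List.mem_of_find?_eq_some hx
  obtain ⟨a, b⟩ := x
  simp only at h1
  subst h1
  exact hm

/-- Under the invariant, every row labelled `c` IS the pivot row of `c`. [folklore] -/
theorem pivRow_eq_of_mem (hS : Inv n t M S) {c : ℕ} {r : List Bool} (h : (some c, r) ∈ S) : pivRow S c = some r := by
  have hsome : isPiv S c = true := isPiv_iff.2 ⟨_, h, rfl⟩
  rw [isPiv, Option.isSome_iff_exists] at hsome
  obtain ⟨r', hr'⟩ := hsome
  have hm := mem_of_pivRow hr'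
  have := hS.excl (some c, r) h (some c, r') hm c rfl (hS.label _ h c rfl).2
  rw [hr']
  simpa using this.symm

/-- A pivot row has a `1` at its label … [folklore] -/
theorem getD_label (hS : Inv n t M S) {c : ℕ} {r : List Bool} (h : (some c, r) ∈ S) : r.getD c false = true :=
  (hS.label _ h c rfl).2

/-- … a label is a swept column … [folklore] -/
theorem label_lt (hS : Inv n t M S) {c : ℕ} {r : List Bool} (h : (some c, r) ∈ S) : c < t :=
  (hS.label _ h c rfl).1

/-- … and a `0` at every other pivot column. [folklore] -/
theorem getD_pivot_ne (hS : Inv n t M S) {c c' : ℕ} {r : List Bool} (h : (some c, r) ∈ S) (hc' : isPiv S c' = true)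
    (hne : c' ≠ c) : r.getD c' false = false := by
  obtain ⟨y, hy, hy1⟩ := isPiv_iff.1 hc'
  by_contra hr
  rw [Bool.not_eq_false] at hr
  have := hS.excl (some c, r) h y hy c' hy1 hr
  rw [← this] at hy1
  exact hne (Option.some.inj hy1).symm

/-- Unlabelled rows of the final state read as `0`. [folklore] -/
theorem vecZ_unlab (hS : Inv n n M S) {r : List Bool} (h : (none, r) ∈ S) : vecZ n r = 0 := by
  funext i
  simp only [vecZ, Pi.zero_apply, toZ_eq_zero_iff]
  exact hS.unlab _ h rfl i i.2

/-- The pivot entry `(pivRow c)_f` (`false` if `c` is not a pivot column). [folklore] -/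
def pe (S : List Row) (c f : ℕ) : Bool := (pivRow S c).elim false fun r => r.getD f false

/-- `kEntry` through the pivot entries `pe`. [folklore] -/
theorem kEntry_eq (S : List Row) (f c : ℕ) : kEntry S f c = (decide (c = f) || pe S c f) := rfl

/-- `pe` at a pivot column reads the pivot row. [folklore] -/
theorem pe_of_pivRow {S : List Row} {c f : ℕ} {r : List Bool} (h : pivRow S c = some r) : pe S c f = r.getD f false := by
  rw [pe, h]; rfl

/-- `pe` vanishes at a non-pivot column. [folklore] -/
theorem pe_of_not_isPiv {S : List Row} {c : ℕ} (h : isPiv S c = false) (f : ℕ) : pe S c f = false := by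
  rw [isPiv, Option.isSome_eq_false_iff, Option.isNone_iff_eq_none] at h
  rw [pe, h]; rfl

/-- Entries of `kvec`. [folklore] -/
theorem getD_kvec {S : List Row} {f c : ℕ} (hc : c < n) : (kvec n S f).getD c false = (decide (c = f) || pe S c f) := by
  rw [kvec, List.getD_eq_getElem _ _ (by simpa using hc)]
  simp [kEntry_eq]

/-- The pivot columns, as a finset of coordinates. [folklore] -/
def pivs (n : ℕ) (S : List Row) : Finset (Fin n) := univ.filter fun c => isPiv S c = true

/-- The free columns. [folklore] -/
def frees (n : ℕ) (S : List Row) : Finset (Fin n) := univ.filter fun c => isPiv S c = false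

/-- Membership in `pivs`. [folklore] -/
theorem mem_pivs {c : Fin n} : c ∈ pivs n S ↔ isPiv S c = true := by simp [pivs]

/-- Membership in `frees`. [folklore] -/
theorem mem_frees {c : Fin n} : c ∈ frees n S ↔ isPiv S c = false := by simp [frees]

/-- `frees` as the complement filter of `pivs`. [folklore] -/
theorem frees_eq_filter_not : frees n S = univ.filter fun c : Fin n => ¬ (isPiv S c = true) := by
  ext c; simp [frees]

/-- **The reading of a pivot row**: `1` at its label, `0` at the other pivot columns, the pivot
entries at the free columns. [folklore] -/
theorem vecZ_pivRow (hS : Inv n n M S) {c : Fin n} {r : List Bool} (h : pivRow S c = some r) (i : Fin n) :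
    vecZ n r i = (if i = c then 1 else 0) + (if isPiv S i = true then 0 else toZ (pe S c i)) := by
  have hm := mem_of_pivRow h
  simp only [vecZ]
  by_cases hic : i = c
  · subst hic
    rw [getD_label hS hm, if_pos rfl, if_pos (isPiv_iff.2 ⟨_, hm, rfl⟩)]; rfl
  · rw [if_neg hic, zero_add]
    by_cases hp : isPiv S i = true
    · rw [if_pos hp, getD_pivot_ne hS hm hp (fun e => hic (Fin.ext e))]; rfl
    · rw [if_neg hp, pe_of_pivRow h]

/-- **The reading of a kernel vector** `kvec f` for a free column `f`. [folklore] -/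
theorem vecZ_kvec {f : Fin n} (hf : isPiv S f = false) (i : Fin n) :
    vecZ n (kvec n S f) i = (if i = f then 1 else 0) + (if isPiv S i = true then toZ (pe S i f) else 0) := by
  simp only [vecZ]
  rw [getD_kvec i.2]
  by_cases hif : i = f
  · subst hif
    simp [hf, BLR.toZ]
  · have : decide ((i : ℕ) = f) = false := by simpa using fun e => hif (Fin.ext e)
    rw [this, Bool.false_or, if_neg hif, zero_add]
    by_cases hp : isPiv S i = true
    · rw [if_pos hp]
    · rw [if_neg hp, pe_of_not_isPiv (by simpa using hp)]; rfl

/-- The dot product of a pivot row with a vector: its label coordinate plus the free part.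
[folklore] -/
theorem dotZ_pivRow (hS : Inv n n M S) {c : Fin n} {r : List Bool} (h : pivRow S c = some r) (d : Fin n → ZMod 2) :
    dotZ (vecZ n r) d = d c + ∑ f ∈ frees n S, toZ (pe S c f) * d f := by
  unfold dotZ
  simp_rw [vecZ_pivRow hS h, add_mul, sum_add_distrib]
  congr 1
  · simp [ite_mul, sum_ite_eq']
  · rw [frees_eq_filter_not, sum_filter]
    refine sum_congr rfl fun i _ => ?_
    split_ifs <;> simp

/-- **The kernel equations of the final state**: `d` is orthogonal to all rows iff for every pivot
column `c`, `d_c = Σ_{f free} (pivRow c)_f · d_f`. [cite: KnuthTAOCP2, §4.6.2 Algorithm N] -/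
theorem mem_kerSet_rows_iff (hS : Inv n n M S) (d : Fin n → ZMod 2) :
    d ∈ kerSet n (rowsOf S) ↔ ∀ c ∈ pivs n S, d c = ∑ f ∈ frees n S, toZ (pe S c f) * d f := by
  constructor
  · intro hd c hc
    rw [mem_pivs, isPiv, Option.isSome_iff_exists] at hc
    obtain ⟨r, hr⟩ := hc
    have h0 := hd r (mem_rowsOf (mem_of_pivRow hr))
    rw [dotZ_pivRow hS hr] at h0
    exact (CharTwo.add_eq_zero (R := ZMod 2)).1 h0
  · intro hd r hr
    obtain ⟨x, hx, rfl⟩ := mem_rowsOf_iff.1 hr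
    obtain ⟨l, r⟩ := x
    cases l with
    | none => rw [vecZ_unlab hS hx, dotZ_zero_left]
    | some c =>
      have hcn : c < n := label_lt hS hx
      have hpr := pivRow_eq_of_mem hS hx
      have := dotZ_pivRow hS (c := ⟨c, hcn⟩) hpr d
      rw [this, hd ⟨c, hcn⟩ (mem_pivs.2 (isPiv_iff.2 ⟨_, hx, rfl⟩)), CharTwo.add_self_eq_zero]


/-! ### Kernel basis and orthogonal complement -/

/-- Orthogonality to a set of vectors passes to its span (the dot product with a fixed vector is
linear). [folklore] -/
theorem dotZ_eq_zero_of_mem_span {A : Set (Fin n → ZMod 2)} {d : Fin n → ZMod 2} (h : ∀ v ∈ A, dotZ v d = 0)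
    {v : Fin n → ZMod 2} (hv : v ∈ Submodule.span (ZMod 2) A) : dotZ v d = 0 := by
  let φ : (Fin n → ZMod 2) →ₗ[ZMod 2] ZMod 2 :=
    { toFun := fun v => dotZ v d
      map_add' := fun u v => dotZ_add_left u v d
      map_smul' := fun a v => dotZ_smul_left a v d }
  have hle : Submodule.span (ZMod 2) A ≤ LinearMap.ker φ := Submodule.span_le.2 fun v hv => h v hv
  exact hle hv

/-- **Same kernel**: the rows of the final state and the rows of `M` have the same orthogonal
vectors (their spans coincide). [cite: VonzurgathenGerhard2013, §12.1] -/
theorem kerSet_rows_eq (hS : Inv n t M S) : kerSet n (rowsOf S) = kerSet n M := by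
  ext d
  constructor
  · intro hd r hr
    refine dotZ_eq_zero_of_mem_span (fun v hv => ?_) (hS.span₂ r hr)
    obtain ⟨r', hr', rfl⟩ := hv
    exact hd r' hr'
  · intro hd r hr
    obtain ⟨x, hx, rfl⟩ := mem_rowsOf_iff.1 hr
    refine dotZ_eq_zero_of_mem_span (fun v hv => ?_) (hS.span₁ x hx)
    obtain ⟨r', hr', rfl⟩ := hv
    exact hd r' hr'

/-- **K1: the kernel vectors lie in the kernel.** [cite: KnuthTAOCP2, §4.6.2 Algorithm N] -/
theorem vecZ_kvec_mem_kerSet_rows (hS : Inv n n M S) {f : Fin n} (hf : isPiv S f = false) :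
    vecZ n (kvec n S f) ∈ kerSet n (rowsOf S) := by
  rw [mem_kerSet_rows_iff hS]
  intro c hc
  rw [mem_pivs] at hc
  have hcf : c ≠ f := fun e => by rw [e, hf] at hc; exact Bool.false_ne_true hc
  rw [vecZ_kvec hf, if_neg hcf, if_pos hc, zero_add]
  have : ∀ f' ∈ frees n S, toZ (pe S c f') * vecZ n (kvec n S f) f' = if f' = f then toZ (pe S c f) else 0 := by
    intro f' hf'
    rw [mem_frees] at hf'
    rw [vecZ_kvec hf]
    simp only [hf', Bool.false_eq_true, if_false, add_zero]
    by_cases e : f' = f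
    · subst e; simp
    · simp [e]
  rw [sum_congr rfl this, sum_ite_eq', if_pos (mem_frees.2 hf)]

/-- **K2: a kernel vector is the sum of the kernel vectors of its free `1`-coordinates.**
[cite: KnuthTAOCP2, §4.6.2 Algorithm N] -/
theorem eq_sum_kvec (hS : Inv n n M S) {d : Fin n → ZMod 2} (hd : d ∈ kerSet n (rowsOf S)) :
    d = ∑ f ∈ frees n S, d f • vecZ n (kvec n S f) := by
  rw [mem_kerSet_rows_iff hS] at hd
  funext i
  rw [Finset.sum_apply]
  simp only [Pi.smul_apply, smul_eq_mul]
  have e : ∀ f ∈ frees n S, d f * vecZ n (kvec n S f) i =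
      (if i = f then d f else 0) + (if isPiv S i = true then toZ (pe S i f) * d f else 0) := by
    intro f hf
    rw [vecZ_kvec (mem_frees.1 hf), mul_add]
    congr 1
    · split_ifs <;> simp
    · split_ifs <;> ring
  rw [sum_congr rfl e, sum_add_distrib, sum_ite_eq]
  by_cases hp : isPiv S i = true
  · simp only [if_pos hp]
    rw [if_neg (by rw [mem_frees, hp]; decide), zero_add]
    exact hd i (mem_pivs.2 hp)
  · simp only [if_neg hp, sum_const_zero, add_zero]
    rw [if_pos (mem_frees.2 (by simpa using hp))]

/-- The pivot row of a pivot column, as a total function. [folklore] -/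
def prow (S : List Row) (c : ℕ) : List Bool := (pivRow S c).getD []

/-- At a pivot column, `pivRow` is `some (prow …)`. [folklore] -/
theorem pivRow_eq_some_prow {c : ℕ} (h : isPiv S c = true) : pivRow S c = some (prow S c) := by
  rw [isPiv] at h
  rw [prow]
  cases hq : pivRow S c with
  | none => rw [hq] at h; exact absurd h (by simp)
  | some r => rfl

/-- **K3: a vector orthogonal to all kernel vectors is a combination of the pivot rows**, hence
lies in the row span. [cite: VonzurgathenGerhard2013, §12.1] -/
theorem eq_sum_prow_of_orth (hS : Inv n n M S) {v : Fin n → ZMod 2}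
    (hv : ∀ f ∈ frees n S, dotZ v (vecZ n (kvec n S f)) = 0) :
    v = ∑ c ∈ pivs n S, v c • vecZ n (prow S c) := by
  funext i
  rw [Finset.sum_apply]
  simp only [Pi.smul_apply, smul_eq_mul]
  have e : ∀ c ∈ pivs n S, v c * vecZ n (prow S c) i =
      (if i = c then v c else 0) + (if isPiv S i = true then 0 else v c * toZ (pe S c i)) := by
    intro c hc
    rw [vecZ_pivRow hS (pivRow_eq_some_prow (mem_pivs.1 hc)), mul_add]
    congr 1
    · split_ifs <;> simp
    · split_ifs <;> ring
  rw [sum_congr rfl e, sum_add_distrib, sum_ite_eq]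
  by_cases hp : isPiv S i = true
  · simp only [if_pos hp, sum_const_zero, add_zero]
    rw [if_pos (mem_pivs.2 hp)]
  · simp only [if_neg hp]
    rw [if_neg (by rw [mem_pivs]; exact hp), zero_add]
    -- the orthogonality to `kvec i` (a free column) gives the coordinate
    have h0 := hv i (mem_frees.2 (by simpa using hp))
    unfold dotZ at h0
    have e2 : ∀ l : Fin n, v l * vecZ n (kvec n S i) l =
        (if l = i then v i else 0) + (if isPiv S l = true then v l * toZ (pe S l i) else 0) := by
      intro l
      rw [vecZ_kvec (by simpa using hp), mul_add]
      congr 1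
      · split_ifs with h <;> simp [h]
      · split_ifs <;> ring
    rw [Fintype.sum_congr _ _ e2, sum_add_distrib, sum_ite_eq' univ i, if_pos (mem_univ _), ← sum_filter] at h0
    exact ((CharTwo.add_eq_zero (R := ZMod 2)).1 h0)

/-- Hence such a vector lies in the row span of the state. [cite: VonzurgathenGerhard2013, §12.1] -/
theorem mem_rowSpan_rows_of_orth (hS : Inv n n M S) {v : Fin n → ZMod 2}
    (hv : ∀ f ∈ frees n S, dotZ v (vecZ n (kvec n S f)) = 0) : v ∈ rowSpan n (rowsOf S) := by
  rw [eq_sum_prow_of_orth hS hv]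
  refine Submodule.sum_mem _ fun c hc => Submodule.smul_mem _ _ (vecZ_mem_rowSpan ?_)
  exact mem_rowsOf (mem_of_pivRow (pivRow_eq_some_prow (mem_pivs.1 hc)))

/-- The row span of the state is contained in the row span of `M`. [folklore] -/
theorem rowSpan_rows_le (hS : Inv n t M S) : rowSpan n (rowsOf S) ≤ rowSpan n M := by
  apply Submodule.span_le.2
  rintro v ⟨r, hr, rfl⟩
  obtain ⟨x, hx, rfl⟩ := mem_rowsOf_iff.1 hr
  exact hS.span₁ x hx

end Final


/-! ### The packaged statements for `rrun n M` -/

section API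

variable {n : ℕ} {M : List (List Bool)}

/-- **Same kernel** for the reduced form. [cite: VonzurgathenGerhard2013, §12.1] -/
theorem kerSet_rrun (n : ℕ) (M : List (List Bool)) : kerSet n (rowsOf (rrun n M)) = kerSet n M :=
  kerSet_rows_eq (inv_rrun n n M)

/-- **K1** for the reduced form: `kvec f ∈ ker M` for every free column `f`.
[cite: KnuthTAOCP2, §4.6.2 Algorithm N] -/
theorem vecZ_kvec_mem_kerSet {f : Fin n} (hf : isPiv (rrun n M) f = false) :
    vecZ n (kvec n (rrun n M) f) ∈ kerSet n M := by
  rw [← kerSet_rrun]; exact vecZ_kvec_mem_kerSet_rows (inv_rrun n n M) hf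

/-- **K2** for the reduced form: kernel vectors are the sums of the `kvec f` over their free
`1`-coordinates; in particular `ker M` is spanned by the `kvec f`, `f` free.
[cite: KnuthTAOCP2, §4.6.2 Algorithm N] -/
theorem eq_sum_kvec_of_mem_kerSet {d : Fin n → ZMod 2} (hd : d ∈ kerSet n M) :
    d = ∑ f ∈ frees n (rrun n M), d f • vecZ n (kvec n (rrun n M) f) :=
  eq_sum_kvec (inv_rrun n n M) (by rwa [kerSet_rrun])

/-- **The kernel equations** for the reduced form. [cite: KnuthTAOCP2, §4.6.2 Algorithm N] -/
theorem mem_kerSet_iff (d : Fin n → ZMod 2) :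
    d ∈ kerSet n M ↔ ∀ c ∈ pivs n (rrun n M), d c = ∑ f ∈ frees n (rrun n M), toZ (pe (rrun n M) c f) * d f := by
  rw [← kerSet_rrun]; exact mem_kerSet_rows_iff (inv_rrun n n M) d

/-- **K3** for the reduced form: a vector orthogonal to the `kvec f` (`f` free) — equivalently to
`ker M` — lies in the row span of `M`. [cite: VonzurgathenGerhard2013, §12.1] -/
theorem mem_rowSpan_of_orth_kvec {v : Fin n → ZMod 2}
    (hv : ∀ f ∈ frees n (rrun n M), dotZ v (vecZ n (kvec n (rrun n M) f)) = 0) : v ∈ rowSpan n M :=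
  rowSpan_rows_le (inv_rrun n n M) (mem_rowSpan_rows_of_orth (inv_rrun n n M) hv)

/-- **K3**, kernel form: `(ker M)^⊥ ⊆ rowSpan M`. [cite: VonzurgathenGerhard2013, §12.1] -/
theorem mem_rowSpan_of_orth_kerSet {v : Fin n → ZMod 2} (hv : ∀ d ∈ kerSet n M, dotZ v d = 0) :
    v ∈ rowSpan n M :=
  mem_rowSpan_of_orth_kvec fun _ hf => hv _ (vecZ_kvec_mem_kerSet (mem_frees.1 hf))

/-- Conversely the row span is orthogonal to the kernel. [folklore] -/
theorem dotZ_eq_zero_of_mem_rowSpan {v d : Fin n → ZMod 2} (hv : v ∈ rowSpan n M) (hd : d ∈ kerSet n M) :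
    dotZ v d = 0 :=
  by
    refine dotZ_eq_zero_of_mem_span (fun w hw => ?_) hv
    obtain ⟨r, hr, rfl⟩ := hw
    exact hd r hr

/-- The row set is the range of the row-reading function. [folklore] -/
theorem rowSet_eq_range (n : ℕ) (M : List (List Bool)) :
    rowSet n M = Set.range fun k : Fin M.length => vecZ n M[k] := by
  ext v
  constructor
  · rintro ⟨r, hr, rfl⟩
    obtain ⟨k, hk, rfl⟩ := List.mem_iff_getElem.1 hr
    exact ⟨⟨k, hk⟩, rfl⟩
  · rintro ⟨k, rfl⟩
    exact ⟨M[k], List.getElem_mem _, rfl⟩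

/-- Members of the row span are explicit combinations of the rows. [folklore] -/
theorem exists_fun_of_mem_rowSpan {v : Fin n → ZMod 2} (hv : v ∈ rowSpan n M) :
    ∃ w : Fin M.length → ZMod 2, v = ∑ k, w k • vecZ n M[k] := by
  rw [rowSpan, rowSet_eq_range, Submodule.mem_span_range_iff_exists_fun] at hv
  obtain ⟨c, hc⟩ := hv
  exact ⟨c, hc.symm⟩

/-- Combinations of the rows lie in the row span. [folklore] -/
theorem sum_smul_mem_rowSpan (w : Fin M.length → ZMod 2) : ∑ k, w k • vecZ n M[k] ∈ rowSpan n M :=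
  Submodule.sum_mem _ fun _ _ => Submodule.smul_mem _ _ (vecZ_mem_rowSpan (List.getElem_mem _))

end API

/-! ### Size of the states -/

section Size

/-- Row lengths and labels along the sweep: rows never get longer than the longest input row,
labels are drawn from the columns swept, the number of rows is constant. [folklore] -/
structure Small (L : ℕ) (cols : List ℕ) (m : ℕ) (S : List Row) : Prop where
  len : S.length = m
  row : ∀ x ∈ S, x.2.length ≤ L
  lab : ∀ x ∈ S, ∀ c, x.1 = some c → c ∈ cols

/-- The initial state is small. [folklore] -/
theorem small_initS {L : ℕ} {M : List (List Bool)} (hL : ∀ r ∈ M, r.length ≤ L) (cols : List ℕ) :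
    Small L cols M.length (initS M) :=
  ⟨by simp [initS], fun x hx => by obtain ⟨r, hr, rfl⟩ := List.mem_map.1 hx; exact hL r hr,
    fun x hx c hc => by obtain ⟨r, -, rfl⟩ := List.mem_map.1 hx; exact absurd hc (by simp)⟩

/-- Smallness is monotone in the list of allowed labels. [folklore] -/
theorem Small.mono {L m : ℕ} {cols cols' : List ℕ} {S : List Row} (h : Small L cols m S) (hc : cols ⊆ cols') :
    Small L cols' m S :=
  ⟨h.len, h.row, fun x hx c hxc => hc (h.lab x hx c hxc)⟩

/-- One column keeps the state small. [folklore] -/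
theorem small_rstep {L m : ℕ} {cols : List ℕ} {S : List Row} (h : Small L cols m S) {j : ℕ} (hj : j ∈ cols) :
    Small L cols m (rstep S j) := by
  by_cases hf : S.findIdx (cand j) < S.length
  swap
  · rwa [rstep_of_not hf]
  have hpL : (pivOf S j).length ≤ L := by
    rw [(pivot_spec hf).2.2]; exact h.row _ (List.getElem_mem hf)
  refine ⟨?_, ?_, ?_⟩
  · rw [rstep, if_pos hf, List.length_cons, List.length_map, List.length_eraseIdx_of_lt hf, ← h.len]
    have := hf; omega
  · intro y hy
    rcases (mem_rstep_iff hf y).1 hy with rfl | ⟨x, hx, rfl⟩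
    · exact hpL
    · have hxL := h.row x (List.mem_of_mem_eraseIdx hx)
      unfold elimRow
      split_ifs
      · simp only [length_bxorL]; exact max_le hxL hpL
      · exact hxL
  · intro y hy c hc
    rcases (mem_rstep_iff hf y).1 hy with rfl | ⟨x, hx, rfl⟩
    · simp only [Option.some.injEq] at hc; exact hc ▸ hj
    · rw [elimRow_fst] at hc; exact h.lab x (List.mem_of_mem_eraseIdx hx) c hc

/-- A sweep over allowed columns keeps the state small. [folklore] -/
theorem small_foldl {L m : ℕ} {cols : List ℕ} (l : List ℕ) (hl : l ⊆ cols) {S : List Row} (h : Small L cols m S) :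
    Small L cols m (l.foldl rstep S) := by
  induction l generalizing S with
  | nil => exact h
  | cons j l ih =>
    rw [List.foldl_cons]
    exact ih (fun x hx => hl (List.mem_cons_of_mem _ hx)) (small_rstep h (hl List.mem_cons_self))

end Size

/-! ### Polynomial time on codes -/

section Code

/-- Code of a row: `⟨optional label, raw bit list⟩`. [folklore] -/
abbrev bitsE : List Bool → List Bool := rawE bitE

/-- Code of a labelled row. [folklore] -/
abbrev rowCE : Row → List Bool := pairE (optE natE) bitsE

/-- Code of a state. [folklore] -/
abbrev stCE : List Row → List Bool := rawE rowCE

/-- `bxorL` on codes. [folklore] -/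
theorem bxorL_codeFP : CodeFP (pairE bitsE bitsE) bitsE (fun p => bxorL p.1 p.2) := by
  have hz := zipWithPadCtx (σ := Unit) (eσ := unitE) (eα := bitE) (eβ := bitE) (eγ := bitE)
    (g := fun t => (t.2.1 ^^ t.2.2)) (dα := fun _ => false) (dβ := fun _ => false)
    (xorBit.comp (snd _ _)) (const _ false) (const _ false)
  exact (hz.comp ((const _ ()).pair (CodeFP.id _))).congr fun p => rfl

/-- Reading an entry of a bit list. [folklore] -/
theorem getDBit_codeFP : CodeFP (pairE bitsE natE) bitE (fun p => p.1.getD p.2 false) :=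
  (rawGetOr bitE).comp ((fst _ _).pair ((snd _ _).pair (const _ false)))

/-- `cand` on codes. [folklore] -/
theorem cand_codeFP : CodeFP (pairE natE rowCE) bitE (fun t => cand t.1 t.2) :=
  (((optIsSome natE).comp (snd _ _).fst').not.and (getDBit_codeFP.comp ((snd _ _).snd'.pair (fst _ _)))).congr
    fun t => by obtain ⟨j, l, r⟩ := t; cases l <;> rfl

/-- The pivot index `findIdx (cand j)`. [folklore] -/
theorem findIdx_codeFP : CodeFP (pairE natE stCE) natE (fun q => q.2.findIdx (cand q.1)) :=
  (findIdxFP (p := fun t : ℕ × Row => cand t.1 t.2) cand_codeFP).congr fun _ => rfl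

/-- The pivot row `pivOf`. [folklore] -/
theorem pivOf_codeFP : CodeFP (pairE natE stCE) bitsE (fun q => pivOf q.2 q.1) :=
  (((rawGetOr rowCE).comp ((snd _ _).pair (findIdx_codeFP.pair (const _ ((none, []) : Row))))).snd').congr fun _ => rfl

/-- `elimRow` on codes: context `(j, p)`, argument the row. [folklore] -/
theorem elimRow_codeFP : CodeFP (pairE (pairE natE bitsE) rowCE) rowCE (fun t => elimRow t.1.1 t.1.2 t.2) := by
  have hx : CodeFP (pairE (pairE natE bitsE) rowCE) rowCE (fun t => t.2) := snd _ _
  have hc : CodeFP (pairE (pairE natE bitsE) rowCE) bitE (fun t => t.2.2.getD t.1.1 false) :=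
    getDBit_codeFP.comp (hx.snd'.pair (fst _ _).fst')
  refine (hc.ite (hx.fst'.pair (bxorL_codeFP.comp (hx.snd'.pair (fst _ _).snd'))) hx).congr fun t => ?_
  unfold elimRow; rfl

/-- `eraseIdx` on codes (as `take i ++ drop (i+1)`). [folklore] -/
theorem eraseIdx_codeFP {α : Type} (eα : α → List Bool) : CodeFP (pairE natE (rawE eα)) (rawE eα) (fun q => q.2.eraseIdx q.1) := by
  have hi : CodeFP (pairE natE (rawE eα)) natE (fun q => q.1) := fst _ _
  have hl : CodeFP (pairE natE (rawE eα)) (rawE eα) (fun q => q.2) := snd _ _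
  have hk : CodeFP (pairE natE (rawE eα)) unE (fun q => min (q.1 + 1) q.2.length) :=
    unOfNatMin.comp (((ulength eα).comp hl).pair (natAdd.comp (hi.pair (const _ 1))))
  refine ((rawAppend eα).comp (((rawTakeNat eα).comp (hi.pair hl)).pair ((rawDropUn eα).comp (hk.pair hl)))).congr
    fun q => ?_
  obtain ⟨i, l⟩ := q
  simp only [List.eraseIdx_eq_take_drop_succ]
  congr 1
  by_cases h : i + 1 ≤ l.length
  · rw [min_eq_left h]
  · push Not at h
    rw [min_eq_right h.le, List.drop_eq_nil_of_le le_rfl, List.drop_eq_nil_of_le h.le]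

/-- **One column on codes**: `(j, S) ↦ rstep S j`. [cite: AroraBarak2009, §1.3] -/
theorem rstep_codeFP : CodeFP (pairE natE stCE) stCE (fun q => rstep q.2 q.1) := by
  have hj : CodeFP (pairE natE stCE) natE (fun q => q.1) := fst _ _
  have hS : CodeFP (pairE natE stCE) stCE (fun q => q.2) := snd _ _
  have hcond : CodeFP (pairE natE stCE) bitE (fun q => decide (q.2.findIdx (cand q.1) < q.2.length)) :=
    natLt.comp (findIdx_codeFP.pair ((natLength rowCE).comp hS))
  have hctx : CodeFP (pairE natE stCE) (pairE natE bitsE) (fun q => (q.1, pivOf q.2 q.1)) := hj.pair pivOf_codeFP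
  have hmap := (CodeFP.map elimRow_codeFP).comp (hctx.pair ((eraseIdx_codeFP rowCE).comp (findIdx_codeFP.pair hS)))
  have hnew : CodeFP (pairE natE stCE) rowCE (fun q => ((some q.1 : Option ℕ), pivOf q.2 q.1)) :=
    ((optSome natE).comp hj).pair pivOf_codeFP
  refine (hcond.ite ((rawCons rowCE).comp (hnew.pair hmap)) hS).congr fun q => ?_
  obtain ⟨j, S⟩ := q
  simp only [rstep, decide_eq_true_eq]

/-- `initS` on codes. [folklore] -/
theorem initS_codeFP : CodeFP (rawE bitsE) stCE initS :=
  (map₀ (eα := bitsE) (eβ := rowCE) (g := fun r => ((none : Option ℕ), r)) ((const _ (none : Option ℕ)).pair (CodeFP.id _))).congr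
    fun _ => rfl

/-- The code of a small state is linear in the number of rows times (label code + row length).
[folklore] -/
theorem length_stCE_le {L m : ℕ} {cols : List ℕ} {S : List Row} (h : Small L cols m S) :
    (stCE S).length ≤ m * (8 * (rawE natE cols).length + 8 * L + 8) := by
  have hrow : ∀ x ∈ S, 2 * (rowCE x).length + 2 ≤ 8 * (rawE natE cols).length + 8 * L + 8 := by
    intro x hx
    have h1 : (optE natE x.1).length ≤ 2 * (rawE natE cols).length := by
      obtain ⟨lab, r⟩ := x
      cases lab with
      | none => exact Nat.zero_le _
      | some c =>
        have hc := length_item_le_length_rawE natE (h.lab _ hx c rfl)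
        simp only [optE, Option.toList, rawE_cons, rawE_nil, length_boolPair, List.length_nil]
        omega
    have h2 : (bitsE x.2).length = 4 * x.2.length := by
      simp only [bitsE, length_rawE, bitE, List.length_singleton, List.map_const', List.sum_replicate, smul_eq_mul]
      ring
    have h3 := h.row x hx
    have : (rowCE x).length = 2 * (optE natE x.1).length + 2 + (bitsE x.2).length := by
      simp only [pairE_apply, length_boolPair]
    rw [this, h2]
    omega
  have : (stCE S).length ≤ S.length * (8 * (rawE natE cols).length + 8 * L + 8) := by
    rw [length_rawE]
    calc ((S.map fun a => 2 * (rowCE a).length + 2)).sum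
        ≤ (S.map fun a => 2 * (rowCE a).length + 2).length • (8 * (rawE natE cols).length + 8 * L + 8) :=
          List.sum_le_card_nsmul _ _ fun x hx => by
            obtain ⟨a, ha, rfl⟩ := List.mem_map.1 hx
            exact hrow a ha
      _ = S.length * (8 * (rawE natE cols).length + 8 * L + 8) := by rw [List.length_map, smul_eq_mul]
  rwa [h.len] at this

/-- Row lengths are bounded by the code length. [folklore] -/
theorem length_row_le_length_rawE {M : List (List Bool)} {r : List Bool} (hr : r ∈ M) : r.length ≤ (rawE bitsE M).length := by
  have h1 := length_item_le_length_rawE bitsE hr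
  have h2 : r.length ≤ (bitsE r).length := length_le_length_rawE bitE r
  omega

/-- **The sweep on codes**: `(cols, M) ↦ cols.foldl rstep (initS M)` for an arbitrary list of
columns. [cite: AroraBarak2009, §1.3 (polynomially bounded loops)] -/
theorem foldl_rstep_codeFP : CodeFP (pairE (rawE bitsE) (rawE natE)) stCE (fun p => p.2.foldl rstep (initS p.1)) := by
  refine CodeFP.foldl (σ := List (List Bool)) (α := ℕ) (β := List Row) (eσ := rawE bitsE) (eα := natE) (eβ := stCE)
    (step := fun _ j S => rstep S j) (init := initS) (rstep_codeFP.comp ((snd _ _).fst'.pair (snd _ _).snd'))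
    initS_codeFP (Polynomial.X * (16 * Polynomial.X + 8)) fun M l₁ l₂ => ?_
  have hs : Small (rawE bitsE M).length (l₁ ++ l₂) M.length (l₁.foldl rstep (initS M)) :=
    small_foldl l₁ (List.subset_append_left _ _) (small_initS (fun r hr => length_row_le_length_rawE hr) _)
  refine (length_stCE_le hs).trans ?_
  set w := pairE (rawE bitsE) (rawE natE) (M, l₁ ++ l₂)
  have hw : w.length = 2 * (rawE bitsE M).length + 2 + (rawE natE (l₁ ++ l₂)).length := by
    simp [w, pairE_apply, length_boolPair]
  have hM : M.length ≤ (rawE bitsE M).length := length_le_length_rawE _ _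
  simp only [Polynomial.eval_mul, Polynomial.eval_add, Polynomial.eval_X, Polynomial.eval_ofNat]
  calc M.length * (8 * (rawE natE (l₁ ++ l₂)).length + 8 * (rawE bitsE M).length + 8)
      ≤ w.length * (16 * w.length + 8) := Nat.mul_le_mul (by omega) (by omega)

/-- **The reduced form on codes**: `(t, M) ↦ rrun t M` (`t` unary). [cite: AroraBarak2009, §1.3] -/
theorem rrun_codeFP : CodeFP (pairE unE (rawE bitsE)) stCE (fun p => rrun p.1 p.2) :=
  (foldl_rstep_codeFP.comp ((snd _ _).pair (urange.comp (fst _ _)))).congr fun _ => rfl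

/-- `pivRow` on codes. [folklore] -/
theorem pivRow_codeFP : CodeFP (pairE natE stCE) (optE bitsE) (fun q => pivRow q.2 q.1) := by
  have hp : CodeFP (pairE natE rowCE) bitE (fun t => t.2.1 == some t.1) :=
    (beq (optE_injective natE_injective)).comp ((snd _ _).fst'.pair ((optSome natE).comp (fst _ _)))
  have hf := rawFind? (p := fun t : ℕ × Row => t.2.1 == some t.1) hp
  have hm := optMap (σ := ℕ) (eσ := natE) (eα := rowCE) (eβ := bitsE) (g := fun t => t.2.2) (snd _ _).snd'
  exact (hm.comp ((fst _ _).pair hf)).congr fun q => by simp [pivRow]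

/-- `isPiv` on codes. [folklore] -/
theorem isPiv_codeFP : CodeFP (pairE natE stCE) bitE (fun q => isPiv q.2 q.1) :=
  (optIsSome bitsE).comp pivRow_codeFP

/-- `pe` on codes: `((c, f), S) ↦ pe S c f`. [folklore] -/
theorem pe_codeFP : CodeFP (pairE (pairE natE natE) stCE) bitE (fun q => pe q.2 q.1.1 q.1.2) := by
  have hpr : CodeFP (pairE (pairE natE natE) stCE) (optE bitsE) (fun q => pivRow q.2 q.1.1) :=
    pivRow_codeFP.comp ((fst _ _).fst'.pair (snd _ _))
  have hk := optCases (σ := ℕ) (eσ := natE) (eα := bitsE) (eδ := bitE)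
    (k := fun f o => o.elim false fun r => r.getD f false) (gnone := fun _ => false) (gsome := fun t => t.2.getD t.1 false)
    (const _ false) (getDBit_codeFP.comp ((snd _ _).pair (fst _ _))) (fun _ => rfl) (fun _ _ => rfl)
  exact (hk.comp ((fst _ _).snd'.pair hpr)).congr fun _ => rfl

/-- `kEntry` on codes: `((f, c), S) ↦ kEntry S f c`. [folklore] -/
theorem kEntry_codeFP : CodeFP (pairE (pairE natE natE) stCE) bitE (fun q => kEntry q.2 q.1.1 q.1.2) :=
  ((natEq.comp ((fst _ _).snd'.pair (fst _ _).fst')).or (pe_codeFP.comp ((((fst _ _).snd').pair (fst _ _).fst').pair (snd _ _)))).congr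
    fun _ => rfl

/-- **The kernel vectors on codes**: `((n, f), S) ↦ kvec n S f` (`n` unary). [cite: AroraBarak2009, §1.3] -/
theorem kvec_codeFP : CodeFP (pairE (pairE unE natE) stCE) bitsE (fun q => kvec q.1.1 q.2 q.1.2) := by
  have hm := CodeFP.map (σ := ℕ × List Row) (eσ := pairE natE stCE) (eα := natE) (eβ := bitE)
    (g := fun t => kEntry t.1.2 t.1.1 t.2) (kEntry_codeFP.comp (((fst _ _).fst'.pair (snd _ _)).pair (fst _ _).snd'))
  exact (hm.comp ((((fst _ _).snd').pair (snd _ _)).pair (urange.comp (fst _ _).fst'))).congr fun _ => rfl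

end Code

end F2Elim

end Literature.Computability.Complexity
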